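import Summits.AtomisticToContinuum.HydrodynamicLimit.Theorems.InformationPercolationEnginePercolationClosesChaosPredictableProjectionPinsker
import Summits.AtomisticToContinuum.HydrodynamicLimit.Theorems.InformationPercolationEnginePercolationClosesChaosPredictableProjectionPartition
import HarnessLib

/-!
# The predictable-projection bound: one step of the filtration

Helper for the line `equilibrium-forecast-chain-rule` of the crux
`InformationPercolationEngine.PercolationClosesChaos` (stmt-AtomisticToContinuum-15178), stub
`stub_predictableProjection`. The ONE-STEP estimate behind the predictable-projection bound: for probability
laws `μ ≪ ν` on `Ω`, a "past" observation `π : Ω → T` and a "next" observation `Z : Ω → S` into countable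
sets (discrete σ-algebras), and an increment `X` that is a function of `(π, Z)` bounded by `C`,

  `∫ |μ[X | σ(π)] - ν[X | σ(π)]| dμ ≤ C √(2 (D₂ - D₁))`,   `D₁ ≤ D₂`,

where `D₁ = Σ'_t ν(π = t) klFun(μ(π = t)/ν(π = t))` and `D₂` is the same sum over the fibres of `(π, Z)`
(the relative entropies of the laws of `π` and of `(π, Z)`, in `klFun` currency). Proof: on a fibre
`{π = t}` of positive mass both conditional expectations are fibre averages, their difference is
`Σ_s g(t, s) (p_t(s) - q_t(s))` for the conditional laws `p_t, q_t` of `Z`, hence `≤ C ‖p_t - q_t‖₁ ≤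
C √(2 D(p_t ‖ q_t))` (countable Pinsker, `tsum_abs_sub_le_sqrt`); the chain-rule identity
`μ(π = t) D(p_t ‖ q_t) = D₂-row(t) - ν(π = t) klFun(μ(π = t)/ν(π = t))` (`hasSum_cond_klFun`) and
Cauchy–Schwarz over the fibres conclude.

## References
* Y. Polyanskiy, Y. Wu, *Information Theory: From Coding to Learning* (2024), Thm. 2.16 (chain rule),
  Thm. 7.10 (Pinsker).
* T. M. Cover, J. A. Thomas, *Elements of Information Theory*, 2nd ed. (2006), Thm. 2.5.3, Lemma 11.6.1.
-/

noncomputable section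

namespace Summit.AtomisticToContinuum.HydrodynamicLimit.Theorems.EquilibriumForecastLine

open MeasureTheory Set InformationTheory Literature.Probability.Process
open scoped ENNReal

variable {Ω : Type*} {mΩ : MeasurableSpace Ω}

/-- A real map measurable for `σ(ρ) = comap ρ ⊤` and bounded by `C ≥ 0` is `g ∘ ρ` with `|g| ≤ C`.
[folklore] -/
theorem exists_eq_comp_of_measurable_comap_top_of_abs_le {R : Type*} {ρ : Ω → R} {X : Ω → ℝ} {C : ℝ}
    (hX : Measurable[MeasurableSpace.comap ρ ⊤] X) (hC : ∀ ω, |X ω| ≤ C) (hC0 : 0 ≤ C) :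
    ∃ g : R → ℝ, (∀ ω, X ω = g (ρ ω)) ∧ ∀ r, |g r| ≤ C := by
  classical
  refine ⟨fun r => if h : ∃ ω, ρ ω = r then X h.choose else 0, fun ω => ?_, fun r => ?_⟩
  · have h : ∃ ω', ρ ω' = ρ ω := ⟨ω, rfl⟩
    show X ω = (if h : ∃ ω', ρ ω' = ρ ω then X h.choose else 0)
    rw [dif_pos h]
    exact apply_eq_of_measurable_comap_top hX h.choose_spec.symm
  · show |(if h : ∃ ω, ρ ω = r then X h.choose else 0)| ≤ C
    split_ifs with h
    · exact hC _
    · simpa using hC0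

/-- **One step of the predictable-projection bound.** For probability laws `μ ≪ ν`, observations
`π : Ω → T` (the past) and `Z : Ω → S` (the next symbol) into countable sets whose joint fibres are
measurable, and `X` a function of `(π, Z)` with `|X| ≤ C`: if `D₁` is the `klFun`-divergence of the laws of
`π` and `D₂` that of the laws of `(π, Z)` (both as sums over fibres), then `D₁ ≤ D₂` (chain rule) and
`∫ |μ[X | σ(π)] - ν[X | σ(π)]| dμ ≤ C √(2 (D₂ - D₁))` (fibre averages + Pinsker + Cauchy–Schwarz).
[folklore] -/
theorem integral_abs_condExp_sub_condExp_le {Ω : Type*} {mΩ : MeasurableSpace Ω} {T S : Type*}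
    [Countable T] [Countable S] (μ ν : Measure Ω) [IsProbabilityMeasure μ] [IsProbabilityMeasure ν]
    (hμν : μ ≪ ν) (π : Ω → T) (Z : Ω → S)
    (hρ : MeasurableSpace.comap (fun ω => (π ω, Z ω)) ⊤ ≤ mΩ) {X : Ω → ℝ} {C : ℝ}
    (hX : Measurable[MeasurableSpace.comap (fun ω => (π ω, Z ω)) ⊤] X) (hC : ∀ ω, |X ω| ≤ C)
    {D₁ D₂ : ℝ}
    (hD₁ : HasSum (fun t => ν.real (π ⁻¹' {t}) * klFun (μ.real (π ⁻¹' {t}) / ν.real (π ⁻¹' {t}))) D₁)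
    (hD₂ : HasSum (fun p : T × S => ν.real ((fun ω => (π ω, Z ω)) ⁻¹' {p}) *
      klFun (μ.real ((fun ω => (π ω, Z ω)) ⁻¹' {p}) / ν.real ((fun ω => (π ω, Z ω)) ⁻¹' {p}))) D₂) :
    D₁ ≤ D₂ ∧
      ∫ ω, |μ[X | MeasurableSpace.comap π ⊤] ω - ν[X | MeasurableSpace.comap π ⊤] ω| ∂μ ≤
        C * Real.sqrt (2 * (D₂ - D₁)) := by
  classical
  set ρ : Ω → T × S := fun ω => (π ω, Z ω) with hρ_def
  -- σ-algebras and measurability of fibres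
  have hπρ : MeasurableSpace.comap π ⊤ ≤ MeasurableSpace.comap ρ ⊤ :=
    comap_top_le_comap_top_of_forall_eq fun a b hab => congrArg Prod.fst hab
  have hZρ : MeasurableSpace.comap Z ⊤ ≤ MeasurableSpace.comap ρ ⊤ :=
    comap_top_le_comap_top_of_forall_eq fun a b hab => congrArg Prod.snd hab
  have hle : MeasurableSpace.comap π ⊤ ≤ mΩ := hπρ.trans hρ
  have hA : ∀ t, MeasurableSet (π ⁻¹' {t}) := fun t => hle _ (measurableSet_comap_top_fibre π t)
  have hB : ∀ p, MeasurableSet (ρ ⁻¹' {p}) := fun p => hρ _ (measurableSet_comap_top_fibre ρ p)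
  have hZm : ∀ s, MeasurableSet (Z ⁻¹' {s}) := fun s =>
    (hZρ.trans hρ) _ (measurableSet_comap_top_fibre Z s)
  have hfib : ∀ t s, π ⁻¹' {t} ∩ Z ⁻¹' {s} = ρ ⁻¹' {(t, s)} := by
    intro t s
    ext ω
    simp [hρ_def, Prod.ext_iff]
  -- nonemptiness, `0 ≤ C`, integrability of `X`, `X = g ∘ ρ`
  have hC0 : 0 ≤ C := (abs_nonneg _).trans (hC (nonempty_of_isProbabilityMeasure μ).some)
  have hXm : Measurable X := hX.mono hρ le_rfl
  have hXμ : Integrable X μ := (integrable_const C).mono' hXm.aestronglyMeasurable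
    (Filter.Eventually.of_forall fun ω => by rw [Real.norm_eq_abs]; exact hC ω)
  have hXν : Integrable X ν := (integrable_const C).mono' hXm.aestronglyMeasurable
    (Filter.Eventually.of_forall fun ω => by rw [Real.norm_eq_abs]; exact hC ω)
  obtain ⟨g, hg, hgC⟩ := exists_eq_comp_of_measurable_comap_top_of_abs_le hX hC hC0
  -- masses: absolute continuity on atoms, fibre sums
  have hacB : ∀ p, ν.real (ρ ⁻¹' {p}) = 0 → μ.real (ρ ⁻¹' {p}) = 0 := fun p hp =>
    (measureReal_eq_zero_iff (measure_ne_top μ _)).2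
      (hμν ((measureReal_eq_zero_iff (measure_ne_top ν _)).1 hp))
  have hP' : ∀ t, HasSum (fun s => μ.real (ρ ⁻¹' {(t, s)})) (μ.real (π ⁻¹' {t})) := fun t => by
    simpa only [hfib] using hasSum_measureReal_inter_fibre μ Z hZm (hA t)
  have hQ' : ∀ t, HasSum (fun s => ν.real (ρ ⁻¹' {(t, s)})) (ν.real (π ⁻¹' {t})) := fun t => by
    simpa only [hfib] using hasSum_measureReal_inter_fibre ν Z hZm (hA t)
  have hP1 : HasSum (fun t => μ.real (π ⁻¹' {t})) 1 := by
    simpa only [univ_inter, probReal_univ] using hasSum_measureReal_inter_fibre μ π hA MeasurableSet.univ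
  -- rows of `D₂` and the conditional terms `CT t = row(t) - ν(π = t) klFun(μ(π = t)/ν(π = t)) ≥ 0`
  have hrow : ∀ t, HasSum (fun s => ν.real (ρ ⁻¹' {(t, s)}) *
      klFun (μ.real (ρ ⁻¹' {(t, s)}) / ν.real (ρ ⁻¹' {(t, s)})))
      (∑' s, ν.real (ρ ⁻¹' {(t, s)}) * klFun (μ.real (ρ ⁻¹' {(t, s)}) / ν.real (ρ ⁻¹' {(t, s)}))) :=
    fun t => (hD₂.summable.prod_factor t).hasSum
  set R : T → ℝ := fun t =>
    ∑' s, ν.real (ρ ⁻¹' {(t, s)}) * klFun (μ.real (ρ ⁻¹' {(t, s)}) / ν.real (ρ ⁻¹' {(t, s)})) with hR_def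
  have hRsum : HasSum R D₂ := hD₂.prod_fiberwise hrow
  set CT : T → ℝ := fun t =>
    R t - ν.real (π ⁻¹' {t}) * klFun (μ.real (π ⁻¹' {t}) / ν.real (π ⁻¹' {t})) with hCT_def
  have hCT0 : ∀ t, 0 ≤ CT t := fun t =>
    sub_nonneg.2 (mul_klFun_div_le_tsum (fun _ => measureReal_nonneg) (fun _ => measureReal_nonneg)
      (hP' t) (hQ' t) (fun s => hacB (t, s)) (hrow t).summable)
  have hCTsum : HasSum CT (D₂ - D₁) := hRsum.sub hD₁
  have hD12 : D₁ ≤ D₂ := by linarith [hCTsum.nonneg hCT0]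
  refine ⟨hD12, ?_⟩
  -- the bound on one fibre of `π`
  have hfibre : ∀ t,
      ∫ x in π ⁻¹' {t}, |μ[X | MeasurableSpace.comap π ⊤] x - ν[X | MeasurableSpace.comap π ⊤] x| ∂μ ≤
        C * (Real.sqrt (μ.real (π ⁻¹' {t})) * Real.sqrt (2 * CT t)) := by
    intro t
    have hP't := hP' t
    have hQ't := hQ' t
    have hrowt := hrow t
    by_cases hPt : μ (π ⁻¹' {t}) = 0
    · rw [setIntegral_measure_zero _ hPt]
      exact mul_nonneg hC0 (mul_nonneg (Real.sqrt_nonneg _) (Real.sqrt_nonneg _))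
    have hQt : ν (π ⁻¹' {t}) ≠ 0 := fun h => hPt (hμν h)
    have hPr : μ.real (π ⁻¹' {t}) ≠ 0 := fun h =>
      hPt ((measureReal_eq_zero_iff (measure_ne_top μ _)).1 h)
    have hQr : ν.real (π ⁻¹' {t}) ≠ 0 := fun h =>
      hQt ((measureReal_eq_zero_iff (measure_ne_top ν _)).1 h)
    have hPpos : 0 < μ.real (π ⁻¹' {t}) := lt_of_le_of_ne measureReal_nonneg (Ne.symm hPr)
    rw [setIntegral_abs_condExp_sub_condExp_fibre μ ν hle hXμ hXν hPt hQt]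
    -- the two fibre integrals of `X` as sums over the next symbol
    have hIμ : HasSum (fun s => μ.real (ρ ⁻¹' {(t, s)}) * g (t, s)) (∫ x in π ⁻¹' {t}, X x ∂μ) := by
      have h := hasSum_setIntegral_inter_fibre μ Z hZm (hA t) hXμ
      simp only [hfib] at h
      have e : (fun s => ∫ x in ρ ⁻¹' {(t, s)}, X x ∂μ) = fun s => μ.real (ρ ⁻¹' {(t, s)}) * g (t, s) :=
        funext fun s => setIntegral_fibre_eq_mul μ hg hB (t, s)
      rwa [e] at h
    have hIν : HasSum (fun s => ν.real (ρ ⁻¹' {(t, s)}) * g (t, s)) (∫ x in π ⁻¹' {t}, X x ∂ν) := by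
      have h := hasSum_setIntegral_inter_fibre ν Z hZm (hA t) hXν
      simp only [hfib] at h
      have e : (fun s => ∫ x in ρ ⁻¹' {(t, s)}, X x ∂ν) = fun s => ν.real (ρ ⁻¹' {(t, s)}) * g (t, s) :=
        funext fun s => setIntegral_fibre_eq_mul ν hg hB (t, s)
      rwa [e] at h
    -- the conditional laws `p_t, q_t` of the next symbol on the fibre
    have hp0 : ∀ s, 0 ≤ μ.real (ρ ⁻¹' {(t, s)}) / μ.real (π ⁻¹' {t}) := fun s =>
      div_nonneg measureReal_nonneg measureReal_nonneg
    have hq0 : ∀ s, 0 ≤ ν.real (ρ ⁻¹' {(t, s)}) / ν.real (π ⁻¹' {t}) := fun s =>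
      div_nonneg measureReal_nonneg measureReal_nonneg
    have hp1 : HasSum (fun s => μ.real (ρ ⁻¹' {(t, s)}) / μ.real (π ⁻¹' {t})) 1 := by
      have h := hP't.div_const (μ.real (π ⁻¹' {t}))
      rwa [div_self hPr] at h
    have hq1 : HasSum (fun s => ν.real (ρ ⁻¹' {(t, s)}) / ν.real (π ⁻¹' {t})) 1 := by
      have h := hQ't.div_const (ν.real (π ⁻¹' {t}))
      rwa [div_self hQr] at h
    have hpq : ∀ s, ν.real (ρ ⁻¹' {(t, s)}) / ν.real (π ⁻¹' {t}) = 0 →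
        μ.real (ρ ⁻¹' {(t, s)}) / μ.real (π ⁻¹' {t}) = 0 := fun s hs => by
      rcases div_eq_zero_iff.1 hs with h | h
      · rw [hacB (t, s) h, zero_div]
      · exact absurd h hQr
    -- chain-rule identity on the fibre, and Pinsker
    have hDpq : HasSum (fun s => ν.real (ρ ⁻¹' {(t, s)}) / ν.real (π ⁻¹' {t}) *
        klFun (μ.real (ρ ⁻¹' {(t, s)}) / μ.real (π ⁻¹' {t}) /
          (ν.real (ρ ⁻¹' {(t, s)}) / ν.real (π ⁻¹' {t})))) (CT t / μ.real (π ⁻¹' {t})) :=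
      hasSum_cond_klFun (fun _ => measureReal_nonneg) (fun _ => measureReal_nonneg) hP't hQ't hPr hQr
        (fun s => hacB (t, s)) hrowt
    have hpins : ∑' s, |μ.real (ρ ⁻¹' {(t, s)}) / μ.real (π ⁻¹' {t}) -
        ν.real (ρ ⁻¹' {(t, s)}) / ν.real (π ⁻¹' {t})| ≤ Real.sqrt (2 * (CT t / μ.real (π ⁻¹' {t}))) := by
      have h := tsum_abs_sub_le_sqrt hp0 hq0 hp1 hq1 hpq hDpq.summable
      rwa [hDpq.tsum_eq] at h
    -- the difference of the two fibre averages is `Σ_s g(t, s) (p_t(s) - q_t(s))`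
    have hdiff : HasSum (fun s => g (t, s) * (μ.real (ρ ⁻¹' {(t, s)}) / μ.real (π ⁻¹' {t}) -
        ν.real (ρ ⁻¹' {(t, s)}) / ν.real (π ⁻¹' {t})))
        ((μ.real (π ⁻¹' {t}))⁻¹ * ∫ x in π ⁻¹' {t}, X x ∂μ -
          (ν.real (π ⁻¹' {t}))⁻¹ * ∫ x in π ⁻¹' {t}, X x ∂ν) := by
      have h := (hIμ.mul_left (μ.real (π ⁻¹' {t}))⁻¹).sub (hIν.mul_left (ν.real (π ⁻¹' {t}))⁻¹)
      have e : (fun s => (μ.real (π ⁻¹' {t}))⁻¹ * (μ.real (ρ ⁻¹' {(t, s)}) * g (t, s)) -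
          (ν.real (π ⁻¹' {t}))⁻¹ * (ν.real (ρ ⁻¹' {(t, s)}) * g (t, s))) =
          fun s => g (t, s) * (μ.real (ρ ⁻¹' {(t, s)}) / μ.real (π ⁻¹' {t}) -
            ν.real (ρ ⁻¹' {(t, s)}) / ν.real (π ⁻¹' {t})) := funext fun s => by ring
      rwa [e] at h
    have habs : Summable fun s => |μ.real (ρ ⁻¹' {(t, s)}) / μ.real (π ⁻¹' {t}) -
        ν.real (ρ ⁻¹' {(t, s)}) / ν.real (π ⁻¹' {t})| :=
      Summable.of_nonneg_of_le (fun _ => abs_nonneg _)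
        (fun s => abs_sub_le_iff.2 ⟨by linarith [hp0 s, hq0 s], by linarith [hp0 s, hq0 s]⟩)
        (hp1.summable.add hq1.summable)
    have hup : (μ.real (π ⁻¹' {t}))⁻¹ * ∫ x in π ⁻¹' {t}, X x ∂μ -
        (ν.real (π ⁻¹' {t}))⁻¹ * ∫ x in π ⁻¹' {t}, X x ∂ν ≤
        C * ∑' s, |μ.real (ρ ⁻¹' {(t, s)}) / μ.real (π ⁻¹' {t}) -
          ν.real (ρ ⁻¹' {(t, s)}) / ν.real (π ⁻¹' {t})| := by
      refine hasSum_le (fun s => ?_) hdiff (habs.hasSum.mul_left C)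
      refine (le_abs_self _).trans ?_
      rw [abs_mul]
      exact mul_le_mul_of_nonneg_right (hgC _) (abs_nonneg _)
    have hlo : -(C * ∑' s, |μ.real (ρ ⁻¹' {(t, s)}) / μ.real (π ⁻¹' {t}) -
          ν.real (ρ ⁻¹' {(t, s)}) / ν.real (π ⁻¹' {t})|) ≤
        (μ.real (π ⁻¹' {t}))⁻¹ * ∫ x in π ⁻¹' {t}, X x ∂μ -
          (ν.real (π ⁻¹' {t}))⁻¹ * ∫ x in π ⁻¹' {t}, X x ∂ν := by
      refine hasSum_le (fun s => ?_) (habs.hasSum.mul_left C).neg hdiff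
      refine le_trans (neg_le_neg ?_) (neg_abs_le _)
      rw [abs_mul]
      exact mul_le_mul_of_nonneg_right (hgC _) (abs_nonneg _)
    have hbound := abs_le.2 ⟨hlo, hup⟩
    -- assemble: `P |diff| ≤ P C √(2 CT / P) = C √P √(2 CT)`
    calc μ.real (π ⁻¹' {t}) * |(μ.real (π ⁻¹' {t}))⁻¹ * ∫ x in π ⁻¹' {t}, X x ∂μ -
          (ν.real (π ⁻¹' {t}))⁻¹ * ∫ x in π ⁻¹' {t}, X x ∂ν|
        ≤ μ.real (π ⁻¹' {t}) * (C * Real.sqrt (2 * (CT t / μ.real (π ⁻¹' {t})))) :=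
          mul_le_mul_of_nonneg_left (hbound.trans (mul_le_mul_of_nonneg_left hpins hC0)) hPpos.le
      _ = C * (Real.sqrt (μ.real (π ⁻¹' {t})) * Real.sqrt (2 * CT t)) := by
          rw [show (2 : ℝ) * (CT t / μ.real (π ⁻¹' {t})) = 2 * CT t / μ.real (π ⁻¹' {t}) by ring,
            Real.sqrt_div' _ hPpos.le,
            show μ.real (π ⁻¹' {t}) * (C * (Real.sqrt (2 * CT t) / Real.sqrt (μ.real (π ⁻¹' {t})))) =
              C * (μ.real (π ⁻¹' {t}) / Real.sqrt (μ.real (π ⁻¹' {t})) * Real.sqrt (2 * CT t)) by ring,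
            Real.div_sqrt]
  -- sum over the fibres of `π` (Cauchy–Schwarz with the weights `μ(π = t)`)
  by_cases hint : Integrable
      (fun ω => |μ[X | MeasurableSpace.comap π ⊤] ω - ν[X | MeasurableSpace.comap π ⊤] ω|) μ
  swap
  · rw [integral_undef hint]
    exact mul_nonneg hC0 (Real.sqrt_nonneg _)
  have hInt : HasSum
      (fun t => ∫ x in π ⁻¹' {t}, |μ[X | MeasurableSpace.comap π ⊤] x - ν[X | MeasurableSpace.comap π ⊤] x| ∂μ)
      (∫ ω, |μ[X | MeasurableSpace.comap π ⊤] ω - ν[X | MeasurableSpace.comap π ⊤] ω| ∂μ) := by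
    simpa only [univ_inter, Measure.restrict_univ] using
      hasSum_setIntegral_inter_fibre μ π hA MeasurableSet.univ hint
  have h2CT : HasSum (fun t => 2 * CT t) (2 * (D₂ - D₁)) := hCTsum.mul_left 2
  refine hasSum_le_of_sum_le hInt fun F => ?_
  calc ∑ t ∈ F, ∫ x in π ⁻¹' {t}, |μ[X | MeasurableSpace.comap π ⊤] x - ν[X | MeasurableSpace.comap π ⊤] x| ∂μ
      ≤ ∑ t ∈ F, C * (Real.sqrt (μ.real (π ⁻¹' {t})) * Real.sqrt (2 * CT t)) :=
        Finset.sum_le_sum fun t _ => hfibre t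
    _ = C * ∑ t ∈ F, Real.sqrt (μ.real (π ⁻¹' {t})) * Real.sqrt (2 * CT t) := by rw [Finset.mul_sum]
    _ ≤ C * (Real.sqrt (∑ t ∈ F, μ.real (π ⁻¹' {t})) * Real.sqrt (∑ t ∈ F, 2 * CT t)) :=
        mul_le_mul_of_nonneg_left (Real.sum_sqrt_mul_sqrt_le F (fun _ => measureReal_nonneg)
          (fun t => mul_nonneg zero_le_two (hCT0 t))) hC0
    _ ≤ C * (Real.sqrt 1 * Real.sqrt (2 * (D₂ - D₁))) :=
        mul_le_mul_of_nonneg_left (mul_le_mul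
          (Real.sqrt_le_sqrt (sum_le_hasSum F (fun t _ => measureReal_nonneg) hP1))
          (Real.sqrt_le_sqrt (sum_le_hasSum F (fun t _ => mul_nonneg zero_le_two (hCT0 t)) h2CT))
          (Real.sqrt_nonneg _) (Real.sqrt_nonneg _)) hC0
    _ = C * Real.sqrt (2 * (D₂ - D₁)) := by rw [Real.sqrt_one, one_mul]

end Summit.AtomisticToContinuum.HydrodynamicLimit.Theorems.EquilibriumForecastLine

end
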